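import Summits.QuantumAdvantage.AdviceFreeQNC0.WalkHardFShots
import Summits.QuantumAdvantage.AdviceFreeQNC0.WalkGapParities
import Literature.Computability.MetaComplexity.TConstantProbDegree
import HarnessLib

/-!
# Cell qa-qnc0 (odd primes `p ≥ 5`, rung R6 `√n`-shots): the fibre's level sets have SMALL PROBABILISTIC DEGREE

Planner qa-qnc0-p2 g14, ROUND-14 §3 (Observations A + B) in the tree's vocabulary (qn-lit g16's recipe, INBOX 21:27Z /
LIT-MEMO-26 §1).  PROVED here, for every prime `p`:

* seed-family plumbing over the Literature `Smolensky.UFam`: `ufam_reindex`, `ufam_fin_join` (join `k` single families,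
  errors add up);
* `GapFibre.classBits` — the fired bits of speed×label class `j : Fin 6` in the fibre `z ↦ ow u z` (indicators of degree
  `≤ D`, `≤ B` of them set when the input fires `≤ B` cuts) and **`promiseParity_classBits`**: their promise parity IS the
  class parity of `WalkGapParities.lean`;
* **`GapFibre.exists_levelSet_factor`** — the three level sets of the named residue are Boolean functions of the six
  promise parities (Obs. A, `namedRes_eq_of_classParity`);
* **`GapFibre.ufam_levelSets`** — hence (STV21 Cor. 19 via qn-lit's `ufam_promiseParity_comp`, joined over the six classes,
  then `UFam.boolPost`) the three level-set indicators of `z ↦ namedRes (ow u z) mod 3` admit ONE uniform seed family over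
  `𝔽_p` of degree `≤ 6·(stvDegree p (B+1) ε · D)` and error `≤ 6ε` — the probabilistic replacement of the exact bound
  `B·D` of `WalkGapShots.lean`;
* `GapFibre.stvDegree_le_sqrt` — at fixed error, `stvDegree p t ε ≤ K_{p,ε}·√t`.

The assembly (rung R6 `WalkHardFShotsSqrt p`) is `WalkHardFShotsSqrt.lean`.  WHAT THIS IS NOT: nothing on the dense residual;
separation NOT moved.
-/

noncomputable section

namespace Summit.QuantumAdvantage.AdviceFreeQNC0

open Classical
open Finset
open Literature.Computability.MetaComplexity Literature.Computability.MetaComplexity.Smolensky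
open Literature.Computability.Complexity

variable {n : ℕ}

/-! ### Seed-family plumbing (over the Literature `UFam`) -/

section UFamTools

variable {F : Type*} [Field F] {L : ℕ}

/-- Reindexing a seed family along any map of index types. -/
theorem ufam_reindex {κ κ' : Type} [Fintype κ] [Fintype κ'] {f : κ → (Fin L → Bool) → Bool} {ε : ℝ} {D : ℕ}
    (h : UFam F f ε D) (e : κ' → κ) : UFam F (fun j => f (e j)) ε D := by
  obtain ⟨Ω, hΩ, hne, G, hdeg, herr⟩ := h
  refine ⟨Ω, hΩ, hne, fun ω j => G ω (e j), fun ω j => hdeg ω (e j), fun x => le_trans ?_ (herr x)⟩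
  exact_mod_cast Finset.card_le_card (fun ω hω => by
    rw [mem_errSet] at hω ⊢
    obtain ⟨j, hj⟩ := hω
    exact ⟨e j, hj⟩)

/-- Joining `k` single seed families into one `Fin k`-indexed family (errors add up). -/
theorem ufam_fin_join {ε : ℝ} {D : ℕ} :
    ∀ (k : ℕ) (f : Fin k → (Fin L → Bool) → Bool),
      (∀ j, UFam F (fun _ : Fin 1 => f j) ε D) → UFam F f (k * ε) D
  | 0, f, _ => by
    refine ⟨Unit, inferInstance, ⟨()⟩, fun _ j => Fin.elim0 j, fun _ j => Fin.elim0 j, fun x => ?_⟩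
    have h0 : errSet (fun (_ : Unit) (j : Fin 0) => (Fin.elim0 j : CubeFn F L)) f x = ∅ :=
      Finset.filter_eq_empty_iff.2 fun _ _ h => by obtain ⟨j, _⟩ := h; exact Fin.elim0 j
    rw [h0, Finset.card_empty]
    simp
  | k + 1, f, h => by
    have ih := ufam_fin_join k (fun j => f j.castSucc) (fun j => h j.castSucc)
    have hs := ih.sumElim (h (Fin.last k))
    have hr := ufam_reindex hs
      (fun j : Fin (k + 1) => if hj : j.val < k then Sum.inl ⟨j.val, hj⟩ else Sum.inr 0)
    have hfe : (fun j : Fin (k + 1) => Sum.elim (fun j : Fin k => f j.castSucc) (fun _ : Fin 1 => f (Fin.last k))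
        (if hj : j.val < k then Sum.inl ⟨j.val, hj⟩ else Sum.inr 0)) = f := by
      funext j
      by_cases hj : j.val < k
      · rw [dif_pos hj, Sum.elim_inl]
        exact congrArg f (Fin.ext rfl)
      · rw [dif_neg hj, Sum.elim_inr]
        exact congrArg f (Fin.ext (by simp [Fin.last]; omega))
    rw [hfe] at hr
    refine hr.mono (le_of_eq ?_) le_rfl
    push_cast; ring

end UFamTools

namespace GapFibre

/-! ### The six class parities are promise parities of low-degree bit maps -/

/-- Class index `j : Fin 6` ↦ `(a, η) = (j / 2, j % 2 + 1)`. -/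
def clsA (j : Fin 6) : ℕ := j.val / 2
/-- Class index `j : Fin 6` ↦ speed `η = j % 2 + 1 ∈ {1, 2}`. -/
def clsE (j : Fin 6) : ℕ := j.val % 2 + 1

/-- The fired bits of class `j` in the fibre: `e_j(z)_g = y_g(ow u z) ∧ [class g = j]`. -/
def classBits (i L c : ℕ) (y : Fin (n + 1) → (Fin n → Bool) → Bool) (u : Fin n → Bool) (j : Fin 6)
    (z : Fin L → Bool) : Fin (n + 1) → Bool :=
  fun g => y g (ow i L u z) && decide (kappa i L c u g.val % 3 = clsA j ∧ speed i g.val = clsE j)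

/-- The class bits have indicators of degree `≤ D` in the fibre variable. -/
theorem ind_classBits_mem_lowDeg {p : ℕ} [Fact p.Prime] {i L c D : ℕ} {y : Fin (n + 1) → (Fin n → Bool) → Bool}
    (hdeg : ∀ g, HasDegF p (y g) D) (u : Fin n → Bool) (j : Fin 6) (g : Fin (n + 1)) :
    (fun z : Fin L → Bool => if classBits i L c y u j z g = true then (1 : ZMod p) else 0) ∈
      lowDeg (ZMod p) L D := by
  unfold classBits
  by_cases hc : kappa i L c u g.val % 3 = clsA j ∧ speed i g.val = clsE j
  · have heq : (fun z : Fin L → Bool =>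
        if (y g (ow i L u z) && decide (kappa i L c u g.val % 3 = clsA j ∧ speed i g.val = clsE j)) = true
        then (1 : ZMod p) else 0) = fun z => if y g (ow i L u z) = true then (1 : ZMod p) else 0 := by
      funext z; simp [hc]
    rw [heq]
    exact ind_comp_ow_mem_lowDeg u (hdeg g)
  · have heq : (fun z : Fin L → Bool =>
        if (y g (ow i L u z) && decide (kappa i L c u g.val % 3 = clsA j ∧ speed i g.val = clsE j)) = true
        then (1 : ZMod p) else 0) = 0 := by
      funext z; simp [hc]
    rw [heq]
    exact Submodule.zero_mem _

/-- The number of fired class-`j` bits is the class count of the fibre's activity pattern. -/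
theorem numOnes_classBits (i L c : ℕ) (y : Fin (n + 1) → (Fin n → Bool) → Bool) (u : Fin n → Bool)
    (j : Fin 6) (z : Fin L → Bool) :
    GateFn.numOnes (classBits i L c y u j z) =
      ((activeCuts y).filter fun g : Fin (n + 1) => (fun g => y g (ow i L u z)) g = true ∧
        kappa i L c u g.val % 3 = clsA j ∧ speed i g.val = clsE j).card := by
  unfold GateFn.numOnes classBits
  congr 1
  ext g
  simp only [mem_filter, mem_univ, true_and, Bool.and_eq_true, decide_eq_true_eq]
  constructor
  · rintro ⟨hy, hc⟩
    exact ⟨by unfold activeCuts; rw [mem_filter]; exact ⟨mem_univ _, _, hy⟩, hy, hc⟩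
  · rintro ⟨_, hy, hc⟩
    exact ⟨hy, hc⟩

/-- At most `B` bits are fired in any class when the input fires at most `B` cuts. -/
theorem numOnes_classBits_le {B : ℕ} (i L c : ℕ) (y : Fin (n + 1) → (Fin n → Bool) → Bool)
    (hshots : ∀ u : Fin n → Bool, (univ.filter fun g : Fin (n + 1) => y g u = true).card ≤ B)
    (u : Fin n → Bool) (j : Fin 6) (z : Fin L → Bool) :
    GateFn.numOnes (classBits i L c y u j z) ≤ B := by
  unfold GateFn.numOnes classBits
  refine le_trans (Finset.card_le_card fun g hg => ?_) (hshots (ow i L u z))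
  rw [mem_filter] at hg ⊢
  simp only [Bool.and_eq_true] at hg
  exact ⟨mem_univ _, hg.2.1⟩

/-- **The class parity is the promise parity of the class bits** (on inputs firing `≤ B` cuts). -/
theorem promiseParity_classBits {B : ℕ} (i L c : ℕ) (y : Fin (n + 1) → (Fin n → Bool) → Bool)
    (hshots : ∀ u : Fin n → Bool, (univ.filter fun g : Fin (n + 1) => y g u = true).card ≤ B)
    (u : Fin n → Bool) (j : Fin 6) (z : Fin L → Bool) :
    promiseParityFn (n + 1) B (classBits i L c y u j z) =
      classParity i L c (activeCuts y) u (fun g => y g (ow i L u z)) (clsA j) (clsE j) := by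
  rw [promiseParityFn_eq_xor (numOnes_classBits_le i L c y hshots u j z)]
  show decide (GateFn.numOnes (classBits i L c y u j z) % 2 = 1) = _
  unfold classParity
  rw [numOnes_classBits]

/-- The six indexed classes cover all classes: agreement of the six indexed parities gives agreement of all. -/
theorem classParity_eq_of_six (i L c : ℕ) (A : Finset (Fin (n + 1))) (u : Fin n → Bool)
    {Y Y' : Fin (n + 1) → Bool}
    (h : ∀ j : Fin 6, classParity i L c A u Y (clsA j) (clsE j) = classParity i L c A u Y' (clsA j) (clsE j))
    (a η : ℕ) : classParity i L c A u Y a η = classParity i L c A u Y' a η := by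
  by_cases hcl : a < 3 ∧ (η = 1 ∨ η = 2)
  · obtain ⟨ha, hη⟩ := hcl
    have hj : ∃ j : Fin 6, clsA j = a ∧ clsE j = η := by
      rcases hη with rfl | rfl
      · exact ⟨⟨2 * a, by omega⟩, by show (2 * a) / 2 = a; omega, by show (2 * a) % 2 + 1 = 1; omega⟩
      · exact ⟨⟨2 * a + 1, by omega⟩, by show (2 * a + 1) / 2 = a; omega,
          by show (2 * a + 1) % 2 + 1 = 2; omega⟩
    obtain ⟨j, rfl, rfl⟩ := hj
    exact h j
  · -- out-of-range class: both filters are empty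
    have hemp : ∀ Y₀ : Fin (n + 1) → Bool, (A.filter fun g : Fin (n + 1) =>
        Y₀ g = true ∧ kappa i L c u g.val % 3 = a ∧ speed i g.val = η) = ∅ := by
      intro Y₀
      rw [Finset.eq_empty_iff_forall_notMem]
      intro g hg
      rw [mem_filter] at hg
      apply hcl
      refine ⟨by have := Nat.mod_lt (kappa i L c u g.val) (show 0 < 3 by norm_num); omega, ?_⟩
      have hs : speed i g.val = 1 ∨ speed i g.val = 2 := by unfold speed; split_ifs <;> simp
      rw [hg.2.2.2] at hs; exact hs
    unfold classParity
    rw [hemp Y, hemp Y']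

/-- The six class parities of the fibre's fired pattern, as functions of `z`. -/
def sixParities (i L c B : ℕ) (y : Fin (n + 1) → (Fin n → Bool) → Bool) (u : Fin n → Bool) :
    Fin 6 → (Fin L → Bool) → Bool :=
  fun j z => promiseParityFn (n + 1) B (classBits i L c y u j z)

/-- **The level sets of the named residue are Boolean functions of the six promise parities.** -/
theorem exists_levelSet_factor {B : ℕ} (i L c : ℕ) (y : Fin (n + 1) → (Fin n → Bool) → Bool)
    (hshots : ∀ u : Fin n → Bool, (univ.filter fun g : Fin (n + 1) => y g u = true).card ≤ B)
    (u : Fin n → Bool) :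
    ∃ φ : Fin 3 → (Fin 6 → Bool) → Bool, ∀ (r : Fin 3) (z : Fin L → Bool),
      φ r (fun j => sixParities i L c B y u j z) = decide (namedRes i L c y u z % 3 = r.val) := by
  refine ⟨fun r v => decide (∃ z : Fin L → Bool, (fun j => sixParities i L c B y u j z) = v ∧
    namedRes i L c y u z % 3 = r.val), fun r z => ?_⟩
  dsimp only
  have key : ∀ z z' : Fin L → Bool, (fun j => sixParities i L c B y u j z) = (fun j => sixParities i L c B y u j z') →
      namedRes i L c y u z = namedRes i L c y u z' := by
    intro z z' hzz'
    refine namedRes_eq_of_classParity i L c y u (classParity_eq_of_six i L c (activeCuts y) u (fun j => ?_))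
    have hj := congrFun hzz' j
    unfold sixParities at hj
    rwa [promiseParity_classBits i L c y hshots u j z, promiseParity_classBits i L c y hshots u j z'] at hj
  by_cases hr : namedRes i L c y u z % 3 = r.val
  · have hex : ∃ z' : Fin L → Bool, (fun j => sixParities i L c B y u j z') = (fun j => sixParities i L c B y u j z) ∧
        namedRes i L c y u z' % 3 = r.val := ⟨z, rfl, hr⟩
    rw [decide_eq_true hr, decide_eq_true hex]
  · have hnex : ¬ ∃ z' : Fin L → Bool, (fun j => sixParities i L c B y u j z') = (fun j => sixParities i L c B y u j z) ∧
        namedRes i L c y u z' % 3 = r.val := by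
      rintro ⟨z', hz', hr'⟩
      exact hr (by rw [key z z' hz'.symm]; exact hr')
    rw [decide_eq_false hr, decide_eq_false hnex]

/-- **Seed family for the level sets of the named residue** (R6 engine): with `≤ B` shots per input and selections of
degree `≤ D`, the three level-set indicators of `z ↦ namedRes (ow u z) mod 3` admit a uniform seed family over `𝔽_p` of
degree `≤ 6·(stvDegree p (B+1) ε · D)` and error `≤ 6ε` (six promise parities, STV21 Cor. 19 via
`ufam_promiseParity_comp`, joined and Boolean-post-processed). -/
theorem ufam_levelSets {p : ℕ} [Fact p.Prime] {i L c D B : ℕ} (y : Fin (n + 1) → (Fin n → Bool) → Bool)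
    (hdeg : ∀ g, HasDegF p (y g) D)
    (hshots : ∀ u : Fin n → Bool, (univ.filter fun g : Fin (n + 1) => y g u = true).card ≤ B)
    (u : Fin n → Bool) {ε : ℝ} (hε : 0 < ε) (hε' : ε < 1 / 2 ^ 100) :
    UFam (ZMod p) (fun (r : Fin 3) (z : Fin L → Bool) => decide (namedRes i L c y u z % 3 = r.val))
      (6 * ε) (6 * (stvDegree p (B + 1) ε * D)) := by
  have hsix : UFam (ZMod p) (sixParities i L c B y u) (6 * ε) (stvDegree p (B + 1) ε * D) := by
    have h := ufam_fin_join (F := ZMod p) 6 (sixParities i L c B y u) (fun j =>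
      ufam_promiseParity_comp p B (classBits i L c y u j) (fun g => ind_classBits_mem_lowDeg hdeg u j g) hε hε')
    exact_mod_cast h
  obtain ⟨φ, hφ⟩ := exists_levelSet_factor i L c y hshots u (B := B)
  have hpost := hsix.boolPost φ
  have hfe : (fun (r : Fin 3) (z : Fin L → Bool) => φ r (fun j => sixParities i L c B y u j z)) =
      fun (r : Fin 3) (z : Fin L → Bool) => decide (namedRes i L c y u z % 3 = r.val) := by
    funext r z; exact hφ r z
  rw [hfe] at hpost
  exact hpost


/-! ### The STV degree at fixed error is `O(√t)` -/

/-- For a fixed error `ε ∈ (0,1)`: `stvDegree p t ε ≤ K·√t` for `t ≥ 1`, with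
`K = stvConst p · (√ℓ + ℓ)`, `ℓ = log₂(1/ε)`. -/
theorem stvDegree_le_sqrt (p t : ℕ) (ht : 1 ≤ t) {ε : ℝ} (hε : 0 < ε) (hε1 : ε < 1) :
    (stvDegree p t ε : ℝ) ≤
      (stvConst p * (Real.sqrt (Real.logb 2 (1 / ε)) + Real.logb 2 (1 / ε))) * Real.sqrt t := by
  have hC : 0 ≤ stvConst p := by unfold stvConst; positivity
  have hℓ : 0 ≤ Real.logb 2 (1 / ε) := Real.logb_nonneg (by norm_num) (by rw [le_div_iff₀ hε]; linarith)
  have ht1 : (1 : ℝ) ≤ Real.sqrt t := by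
    rw [show (1 : ℝ) = Real.sqrt 1 from Real.sqrt_one.symm]
    exact Real.sqrt_le_sqrt (by exact_mod_cast ht)
  have hin : 0 ≤ stvConst p * Real.sqrt (t * Real.logb 2 (1 / ε)) + stvConst p * Real.logb 2 (1 / ε) := by
    positivity
  unfold stvDegree
  calc ((⌊stvConst p * Real.sqrt (t * Real.logb 2 (1 / ε)) + stvConst p * Real.logb 2 (1 / ε)⌋₊ : ℕ) : ℝ)
      ≤ stvConst p * Real.sqrt (t * Real.logb 2 (1 / ε)) + stvConst p * Real.logb 2 (1 / ε) :=
        Nat.floor_le hin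
    _ = stvConst p * (Real.sqrt (Real.logb 2 (1 / ε)) * Real.sqrt t) + stvConst p * Real.logb 2 (1 / ε) * 1 := by
        rw [Real.sqrt_mul (by positivity), mul_comm (Real.sqrt (t : ℝ))]; ring
    _ ≤ stvConst p * (Real.sqrt (Real.logb 2 (1 / ε)) * Real.sqrt t) +
        stvConst p * Real.logb 2 (1 / ε) * Real.sqrt t := by
        have : stvConst p * Real.logb 2 (1 / ε) * 1 ≤ stvConst p * Real.logb 2 (1 / ε) * Real.sqrt t :=
          mul_le_mul_of_nonneg_left ht1 (by positivity)
        linarith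
    _ = (stvConst p * (Real.sqrt (Real.logb 2 (1 / ε)) + Real.logb 2 (1 / ε))) * Real.sqrt t := by ring

end GapFibre


end Summit.QuantumAdvantage.AdviceFreeQNC0

end
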